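import Mathlib
import HarnessLib.Audit
import Summits.PneNP.PneNP.Theorems.PstarUnion

/-!
# MULTI-UNION — the several-outside-variables residual (Rb) of O2, typed (ROUND-25; planner p3 g23, memo `r24/CORE-BOUND-NOTES.md` §14.29 (Rb), §14.30)

FRONTIER range-avoidance ladder, rung F-N3, ROUND 25 (cell `pnp-ideate`).  Restricted-model proof complexity; nothing here bears on `P` versus `NP`.

After FRESH ERASE and the UNION LEMMA (`PstarUnionFive.unionFive_holds`, prover-1 g16) the fresh class of `TerminalFiveA` is settled when ONE outside
variable `z` carries every privates-touching monomial.  This file types the general OUTSIDE-PARTNER class and the two abstract forms it reduces to.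

* `OutsidePartners` / `TerminalFiveOutside` (OPEN) — the instance-level sub-target of `TerminalFiveA`: every monomial of `w₁, w₂` that touches a
  private AND variable of a chord has its OTHER variable OUTSIDE `J₀` (in no output of `J₀`).  Several such variables, hubs (one `z` gating two
  chords), `z` shared by `w₁` and `w₂`, `z` also read linearly — all allowed.  (`TerminalFiveFresh` = the one-`z`, `w₂`-untouched case.)
* `MultiUnionTerminal k` / `MultiUnionFive` (OPEN) — the FIBRE form: fixing the outside variables `ξ ∈ 𝔽₂^k` turns `(w₁, w₂)` into a family of
  hun-clean pairs `(A ξ, W ξ)` with CONSTANT monomial sets, linear parts moving only in AND-type variables and AFFINELY in `ξ`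
  (`(A (ξ+η)).1 = (A ξ).1 ∆ (A η).1 ∆ (A 0).1`), every pair infeasible over `J₀` (T3 is pointwise in `ξ`), every output released by SOME pair
  (M0 is existential in `ξ`).  `UnionTerminal` is `k = 1` with `W` constant.
* `LocalUnionTerminal` / `LocalUnionFive` (OPEN) — the `W`-CONSTANT case in its strongest, index-free form: `UnionTerminal` with the second
  reader `A₁` allowed to DEPEND ON THE OUTPUT `f` it releases (same monomials as `A₀`, AND-type linear difference, infeasible over `J₀`).
  PIN READING (memo §14.30): with `Z = Sol(J₀) ∩ {w₂ = t₂}`, `LocalUnionTerminal` ⟺ `A₀` pinned on `Z` and `J₀ = P₀ ∪ ⋃_{L pinned on Z} R(L)`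
  — every output outside `P₀` is released by SOME pinned AND-form (not necessarily the same one).  It implies `MultiUnionFive` for `W` constant and
  ALL `k` at once (`multiUnionFive_fixed_of_localUnionFive`, proved here), and `UnionFive` (proved in the tree) is its one-form case.
* glue proved here: `localUnionTerminal_of_unionTerminal`, `unionFive_of_localUnionFive`, `multiUnionFive_fixed_of_localUnionFive`,
  `multiUnionFiveFixed_of_multiUnionFive`.  The reduction `MultiUnionFive → TerminalFiveOutside` (the multi-variable union split = `sat_split_fresh`
  iterated over the outside variables, bookkeeping the affine family) is a prover item, to be appended.

STATUS OF `LocalUnionFive` (prover-1 g17 reading of the landed `UnionFive` proof, referee g54 21:48Z for Case B): every node of Case A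
(`forced_of_cover`, the `Z(q) ≠ ∅` witness, the all-(EQ) branch via `eq1_caseA`) resolves the cover at ONE output and is local; in Case B, B-I/B-II/
`reader_dichotomy`/`false_of_path_release` are local, and the two «reader released nowhere ⟹ the other pair is `Terminal`» branches and the same-reader seed
of `single_chord_core` are avoidable (apply the dichotomy to the reader releasing the read chord; a path-released reader is chord-released by
`false_of_path_release`).  The local lemma is being landed as `PstarLocalUnion*`.

Statements and definitions VERBATIM from planner p3 g23's `r25/SketchMultiUnion.lean` (21:42Z).
-/

set_option linter.dupNamespace false -- `Summit.PneNP.PneNP.…`: summit = sub-problem name (D-0017 single-conjunct layout)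

open Finset Literature.Computability.Complexity
open scoped symmDiff
open Summit.PneNP.PneNP.Theorems.PstarTyped (Typed)
open Summit.PneNP.PneNP.Theorems.PstarSALevel (varSet bdry BoundaryExpanding SimpleOverlap)
open Summit.PneNP.PneNP.Theorems.PstarGapOneAll (gval)
open Summit.PneNP.PneNP.Theorems.PstarCoreBound (XorClosed)
open Summit.PneNP.PneNP.Theorems.PstarChordRepair (IsChord)
open Summit.PneNP.PneNP.Theorems.PstarChordBridgeCotree (Peelable)
open Summit.PneNP.PneNP.Theorems.PstarChordBridgeTools (privs)
open Summit.PneNP.PneNP.Theorems.PstarCoreBoundTargets (Terminal TerminalFiveA)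
open Summit.PneNP.PneNP.Theorems.PstarUnion (SatPair UnionTerminal UnionFive)

namespace Summit.PneNP.PneNP.Theorems.PstarMultiUnion

variable {n m : ℕ}

/-! ## §1 The instance-level target: outside partners -/

/-- `v` is OUTSIDE the core: it occurs in no output of `J₀`. -/
def Outside (I : LocalMap 4 n m) (J₀ : Finset (Fin m)) (v : Fin n) : Prop := ∀ j ∈ J₀, v ∉ varSet I j

/-- **OUTSIDE PARTNERS** (w.r.t. the admissible forest `F`): every monomial of `w₁` or `w₂` that touches a private AND variable of a chord
`e ∈ J₀ ∖ F` has its other AND variable OUTSIDE `J₀`.  (CROSS gates `(p_e, p_f)` and literal/forest partners are excluded; hubs, several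
outside variables, outside variables shared between `w₁` and `w₂` or read linearly are all allowed.) -/
def OutsidePartners (I : LocalMap 4 n m) (J₀ F : Finset (Fin m)) (w₁ w₂ : Finset (Fin n) × Finset (Fin m) × Bool) : Prop :=
  ∀ g ∈ w₁.2.1 ∪ w₂.2.1, ∀ v ∈ privs I (J₀ \ F),
    (I.vars g 2 = v → Outside I J₀ (I.vars g 3)) ∧ (I.vars g 3 = v → Outside I J₀ (I.vars g 2))

/-- **TARGET (OPEN): `TerminalFiveA` for outside partners.**  A terminal core with an admissible `F` all of whose privates-touching monomials
have outside partners has at most five outputs.  With no privates-touching monomial this is `card_le_five_of_terminal'`; with all of them on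
one fresh `z` untouched by `w₂` it is `TerminalFiveFresh` (⇐ `UnionFive`, landed).  FRONTIER. -/
@[conjecture] def TerminalFiveOutside : Prop :=
  ∀ (n m r : ℕ) (I : LocalMap 4 n m), I.IsPure xorAndPred → Typed I → SimpleOverlap I → BoundaryExpanding r I →
  ∀ (y : Fin m → Bool) (J₀ : Finset (Fin m)) (w₁ w₂ : Finset (Fin n) × Finset (Fin m) × Bool), Terminal I r y J₀ w₁ w₂ →
    ∀ F ⊆ J₀, Peelable I F → (∀ F', F ⊆ F' → F' ⊆ J₀ → Peelable I F' → F' = F) → (∀ e ∈ J₀ \ F, IsChord I J₀ e) →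
    OutsidePartners I J₀ F w₁ w₂ → J₀.card ≤ 5

/-- `TerminalFiveOutside` is a sub-target of O2. -/
theorem terminalFiveOutside_of_terminalFiveA (h : TerminalFiveA) : TerminalFiveOutside :=
  fun n m r I hI hT hS hB y J₀ w₁ w₂ ht F hF hP hmax hch _ => h n m r I hI hT hS hB y J₀ w₁ w₂ ht F hF hP hmax hch

/-! ## §2 The fibre form: affine families of hun-clean pairs -/

/-- pointwise sum of two fibre indices -/
def fadd {k : ℕ} (ξ η : Fin k → Bool) : Fin k → Bool := fun i => xor (ξ i) (η i)

/-- the zero fibre index -/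
def fzero (k : ℕ) : Fin k → Bool := fun _ => false

/-- An AFFINE family of G-constraints over `𝔽₂^k`: constant monomial set, linear parts an affine function of the index
(`(A (ξ+η)).1 = (A ξ).1 ∆ (A η).1 ∆ (A 0).1`); targets unrestricted (gates between two outside variables move only the constants). -/
def AffineFamily {k : ℕ} (A : (Fin k → Bool) → Finset (Fin n) × Finset (Fin m) × Bool) : Prop :=
  (∀ ξ, (A ξ).2.1 = (A (fzero k)).2.1) ∧ ∀ ξ η, (A (fadd ξ η)).1 = ((A ξ).1 ∆ (A η).1) ∆ (A (fzero k)).1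

/-- **MULTI-UNION-TERMINAL data** (the fibre family of a terminal core over `k` outside variables): a core `J₀` and two affine families
`A, W` of G-constraints over `𝔽₂^k` whose linear parts move only in variables that are not XOR slots of `J₀`, every fibre pair infeasible over
`J₀`, every output of `J₀` released by SOME fibre pair.  Radius bookkeeping on the (constant) monomial sets as in `Terminal`. -/
def MultiUnionTerminal (I : LocalMap 4 n m) (r : ℕ) (y : Fin m → Bool) (J₀ : Finset (Fin m)) (k : ℕ)
    (A W : (Fin k → Bool) → Finset (Fin n) × Finset (Fin m) × Bool) : Prop :=
  J₀.Nonempty ∧ XorClosed I J₀ ∧ J₀.card < r ∧ AffineFamily A ∧ AffineFamily W ∧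
  Disjoint J₀ (A (fzero k)).2.1 ∧ Disjoint J₀ (W (fzero k)).2.1 ∧ (J₀ ∪ (A (fzero k)).2.1 ∪ (W (fzero k)).2.1).card ≤ r ∧
  (∀ ξ, ∀ v ∈ ((A (fzero k)).1 ∆ (A ξ).1) ∪ ((W (fzero k)).1 ∆ (W ξ).1), ∀ j ∈ J₀, I.vars j 0 ≠ v ∧ I.vars j 1 ≠ v) ∧
  (∀ ξ, ¬ SatPair I y J₀ (A ξ) (W ξ)) ∧ (∀ f ∈ J₀, ∃ ξ, SatPair I y (J₀.erase f) (A ξ) (W ξ))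

/-- **MULTI-UNION LEMMA (conjecture MU; OPEN):** a multi-union-terminal core whose (common) monomials avoid the chord privates has at most five
outputs.  `k = 0`: `card_le_five_of_terminal'`; `k = 1`, `W` constant: `UnionFive` (landed).  FRONTIER. -/
@[conjecture] def MultiUnionFive : Prop :=
  ∀ (n m r : ℕ) (I : LocalMap 4 n m), I.IsPure xorAndPred → Typed I → SimpleOverlap I → BoundaryExpanding r I →
  ∀ (y : Fin m → Bool) (J₀ : Finset (Fin m)) (k : ℕ) (A W : (Fin k → Bool) → Finset (Fin n) × Finset (Fin m) × Bool),
    MultiUnionTerminal I r y J₀ k A W →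
    ∀ F ⊆ J₀, Peelable I F → (∀ F', F ⊆ F' → F' ⊆ J₀ → Peelable I F' → F' = F) → (∀ e ∈ J₀ \ F, IsChord I J₀ e) →
    (∀ g ∈ (A (fzero k)).2.1 ∪ (W (fzero k)).2.1, ∀ v ∈ privs I (J₀ \ F), I.vars g 2 ≠ v ∧ I.vars g 3 ≠ v) →
    J₀.card ≤ 5

/-- The `W`-constant sub-case of `MultiUnionFive` (classes Rb1: all outside partners belong to `w₁`). -/
@[conjecture] def MultiUnionFiveFixed : Prop :=
  ∀ (n m r : ℕ) (I : LocalMap 4 n m), I.IsPure xorAndPred → Typed I → SimpleOverlap I → BoundaryExpanding r I →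
  ∀ (y : Fin m → Bool) (J₀ : Finset (Fin m)) (k : ℕ) (A W : (Fin k → Bool) → Finset (Fin n) × Finset (Fin m) × Bool),
    MultiUnionTerminal I r y J₀ k A W → (∀ ξ, W ξ = W (fzero k)) →
    ∀ F ⊆ J₀, Peelable I F → (∀ F', F ⊆ F' → F' ⊆ J₀ → Peelable I F' → F' = F) → (∀ e ∈ J₀ \ F, IsChord I J₀ e) →
    (∀ g ∈ (A (fzero k)).2.1 ∪ (W (fzero k)).2.1, ∀ v ∈ privs I (J₀ \ F), I.vars g 2 ≠ v ∧ I.vars g 3 ≠ v) →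
    J₀.card ≤ 5

/-! ## §3 The local form (`W` constant, the second reader may depend on the released output) -/

/-- **LOCAL UNION-TERMINAL data:** `UnionTerminal` with `∃ A₁` moved inside `∀ f`.  A core `J₀`, a shared hun-clean `w₂`, a base reader `A₀`
with `(A₀, w₂)` infeasible over `J₀`, and for every output `f` SOME reader `A₁` — same monomials as `A₀`, linear part differing from `A₀`'s only
off the XOR slots of `J₀`, `(A₁, w₂)` infeasible over `J₀` — that releases `f` (`A₁ = A₀` allowed). -/
def LocalUnionTerminal (I : LocalMap 4 n m) (r : ℕ) (y : Fin m → Bool) (J₀ : Finset (Fin m))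
    (A₀ w₂ : Finset (Fin n) × Finset (Fin m) × Bool) : Prop :=
  J₀.Nonempty ∧ XorClosed I J₀ ∧ J₀.card < r ∧ Disjoint J₀ A₀.2.1 ∧ Disjoint J₀ w₂.2.1 ∧ (J₀ ∪ A₀.2.1 ∪ w₂.2.1).card ≤ r ∧
  ¬ SatPair I y J₀ A₀ w₂ ∧
  ∀ f ∈ J₀, ∃ A₁ : Finset (Fin n) × Finset (Fin m) × Bool, A₁.2.1 = A₀.2.1 ∧
    (∀ v ∈ A₀.1 ∆ A₁.1, ∀ j ∈ J₀, I.vars j 0 ≠ v ∧ I.vars j 1 ≠ v) ∧ ¬ SatPair I y J₀ A₁ w₂ ∧ SatPair I y (J₀.erase f) A₁ w₂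

/-- **LOCAL UNION LEMMA (OPEN; the strongest `W`-constant form):** a local-union-terminal core with an admissible `F` and hun-clean monomials
(`A₀`'s = every `A₁`'s, and `w₂`'s) has at most five outputs.  FRONTIER. -/
@[conjecture] def LocalUnionFive : Prop :=
  ∀ (n m r : ℕ) (I : LocalMap 4 n m), I.IsPure xorAndPred → Typed I → SimpleOverlap I → BoundaryExpanding r I →
  ∀ (y : Fin m → Bool) (J₀ : Finset (Fin m)) (A₀ w₂ : Finset (Fin n) × Finset (Fin m) × Bool),
    LocalUnionTerminal I r y J₀ A₀ w₂ →
    ∀ F ⊆ J₀, Peelable I F → (∀ F', F ⊆ F' → F' ⊆ J₀ → Peelable I F' → F' = F) → (∀ e ∈ J₀ \ F, IsChord I J₀ e) →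
    (∀ g ∈ A₀.2.1 ∪ w₂.2.1, ∀ v ∈ privs I (J₀ \ F), I.vars g 2 ≠ v ∧ I.vars g 3 ≠ v) →
    J₀.card ≤ 5

/-! ## §4 Glue -/

/-- `UnionTerminal` data are `LocalUnionTerminal` data (take `A₁ f := A₀` or `A₁` according to who releases `f`). -/
theorem localUnionTerminal_of_unionTerminal (I : LocalMap 4 n m) {r : ℕ} {y : Fin m → Bool} {J₀ : Finset (Fin m)}
    {A₀ A₁ w₂ : Finset (Fin n) × Finset (Fin m) × Bool} (h : UnionTerminal I r y J₀ A₀ A₁ w₂) :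
    LocalUnionTerminal I r y J₀ A₀ w₂ := by
  obtain ⟨hne, hX, hr, hG, hd₀, hd₂, hcard, hlin, hT₀, hT₁, hcov⟩ := h
  refine ⟨hne, hX, hr, hd₀, hd₂, hcard, hT₀, fun f hf => ?_⟩
  rcases hcov f hf with h₀ | h₁
  · exact ⟨A₀, rfl, fun v hv => by simp at hv, hT₀, h₀⟩
  · exact ⟨A₁, hG, hlin, hT₁, h₁⟩

/-- Hence the local lemma contains the union lemma (landed; recorded for the strength ordering only). -/
theorem unionFive_of_localUnionFive (h : LocalUnionFive) : UnionFive := by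
  intro n m r I hI hT hS hB y J₀ A₀ A₁ w₂ hU F hF hP hmax hch hun
  exact h n m r I hI hT hS hB y J₀ A₀ w₂ (localUnionTerminal_of_unionTerminal I hU) F hF hP hmax hch hun

/-- **`LocalUnionFive` settles the `W`-constant multi-union lemma for every number of outside variables at once.** -/
theorem multiUnionFive_fixed_of_localUnionFive (h : LocalUnionFive) : MultiUnionFiveFixed := by
  intro n m r I hI hT hS hB y J₀ k A W hM hW F hF hP hmax hch hun
  obtain ⟨hne, hX, hr, hA, hWaff, hdA, hdW, hcard, hlin, hT3, hM0⟩ := hM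
  refine h n m r I hI hT hS hB y J₀ (A (fzero k)) (W (fzero k)) ⟨hne, hX, hr, hdA, hdW, hcard, hT3 _, fun f hf => ?_⟩ F hF hP hmax hch hun
  obtain ⟨ξ, hξ⟩ := hM0 f hf
  refine ⟨A ξ, hA.1 ξ, fun v hv j hj => hlin ξ v (mem_union_left _ hv) j hj, ?_, ?_⟩
  · rw [← hW ξ]; exact hT3 ξ
  · rw [← hW ξ]; exact hξ

/-- The `W`-constant case is a case of the multi-union lemma (strength ordering). -/
theorem multiUnionFiveFixed_of_multiUnionFive (h : MultiUnionFive) : MultiUnionFiveFixed :=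
  fun n m r I hI hT hS hB y J₀ k A W hM _ F hF hP hmax hch hun => h n m r I hI hT hS hB y J₀ k A W hM F hF hP hmax hch hun

end Summit.PneNP.PneNP.Theorems.PstarMultiUnion
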